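import Mathlib

/-!
# Line `docking-census-joining`, stub S4 `stub_ledgerBootstrap`: its three analytic hypotheses are
# LOAD-BEARING (explicit counterexample sequences)

Refuter file (cdisprove gen 5, crux item stmt-CriticalPhenomena-7117 = `SAWTotalPositivity.CriticalBubbleBound`;
`-- Targets` of the picked line `Cruxes/CriticalBubbleBound/Lines/docking-census-joining.lean`).
Pure real analysis; no Theses statement is asserted; nothing here depends on self-avoiding walks.

The stub (the exponent ledger `θ - 1 = κ + π` as a theorem) says: for `κ ≥ 0`, nonnegative `t`
with the Hammersley–Welsh a-priori bound `t_n ≤ e^{K√n}`, an injection `D ≤ K₁ U`, docking entropy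
`c 2^{(κ-1)i} R_i² ≤ D_i` (`i ≥ i₀`) and pinch rarity `U_i ≤ C (i+1)^b 2^{-πi} R_{i+1} + C 2^{-4i}`
(`R_i = Σ_{n ∈ [2^i,2^{i+1})} t_n`), every `s > 1 - (κ+π)` with `s ≥ -3/2` admits `C'` with
`R_i ≤ C' 2^{si}` for all `i`. `LedgerBootstrap side apriori floor` below is that statement with the
side condition on `κ`, the a-priori bound and the floor as parameters;
`ledgerBootstrap_stub_iff` certifies (by `Iff.rfl`) that `LedgerBootstrap (0 ≤ ·) HWApriori (-3/2)`
is the stub VERBATIM. Proved here (drefute's paper mutations, now kernel-checked):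

* `not_ledgerBootstrap_without_kappa_nonneg` — WITHOUT `0 ≤ κ` the statement is FALSE:
  `κ = -2, π = 5`, `t` a spike sequence with `R_i = 2^{-i/2}`, `D = U = 2^{-4i}` satisfy every
  remaining hypothesis (a priori with `K = 0`), `1-(κ+π) = -2 < s := -3/2`, but `R_i ≰ C' 2^{-3i/2}`.
  (For `κ < 0` the conversion factor `2^{(1-κ)i}` eats the `2^{-4i}` tail.)
* `not_ledgerBootstrap_without_apriori` — WITHOUT the a-priori bound it is FALSE:
  `κ = 0, π = 1`, `R_i = 2^{2^i}`, `D_i = U_i = 2^{-i} R_i² = 2^{-i} R_{i+1}` satisfy injection,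
  entropy and rarity exactly, `1-(κ+π) = 0 < s := 1`, but `2^{2^i} ≰ C' 2^{i}`. (So the
  Hammersley–Welsh input `hw_term_upper_bound` is used essentially: a merely exponential a-priori
  bound would not do either — this `t` is within `t_n ≤ 2^n`.)
* `not_ledgerBootstrap_floor_lowered` — the floor `-3/2 ≤ s` is SHARP: with floor `-3/2 - ε`
  (`ε > 0`) the statement is FALSE: `κ = 0, π = 10`, `R_i = 2^{-3i/2}`, `D = U = 2^{-4i}` (rarity
  through the tail alone), `s := -3/2 - min(ε,1)/2`.
Positive side (not this file's to land): the stub itself is true (iterated square roots; drefute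
note `Negative-notes-stub_ledgerBootstrap.md`), size M.
-/

noncomputable section

open scoped BigOperators

namespace Summit.CriticalPhenomena.SAWScalingLimit.Theorems.CriticalBubbleBound.Negative

/-- The Hammersley–Welsh-type a-priori bound of the stub: `t_n ≤ e^{K √n}`. -/
def HWApriori (t : ℕ → ℝ) : Prop := ∃ K : ℝ, ∀ n : ℕ, t n ≤ Real.exp (K * Real.sqrt n)

/-- The ledger bootstrap with the side condition on `κ`, the a-priori bound on `t` and the floor
for `s` as parameters (block sums written inline, exactly as in the stub). -/
def LedgerBootstrap (side : ℝ → Prop) (apriori : (ℕ → ℝ) → Prop) (floor : ℝ) : Prop :=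
  ∀ (κ π : ℝ), side κ →
  ∀ (t D U : ℕ → ℝ), (∀ n : ℕ, 0 ≤ t n) → apriori t →
    (∃ K₁ : ℝ, 0 < K₁ ∧ ∀ i : ℕ, D i ≤ K₁ * U i) →
    (∃ c : ℝ, 0 < c ∧ ∃ i₀ : ℕ, ∀ i : ℕ, i₀ ≤ i →
        c * (2 : ℝ) ^ ((κ - 1) * (i : ℝ)) * (∑ n ∈ Finset.Ico (2 ^ i) (2 ^ (i + 1)), t n) ^ 2 ≤ D i) →
    (∃ C b : ℝ, ∀ i : ℕ,
        U i ≤ C * ((i : ℝ) + 1) ^ b * (2 : ℝ) ^ (-π * (i : ℝ)) *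
            (∑ n ∈ Finset.Ico (2 ^ (i + 1)) (2 ^ (i + 1 + 1)), t n)
          + C * (2 : ℝ) ^ (-(4 : ℝ) * (i : ℝ))) →
    ∀ s : ℝ, 1 - (κ + π) < s → floor ≤ s →
      ∃ C' : ℝ, ∀ i : ℕ, (∑ n ∈ Finset.Ico (2 ^ i) (2 ^ (i + 1)), t n) ≤ C' * (2 : ℝ) ^ (s * (i : ℝ))

/-- READ-BACK: with side condition `0 ≤ κ`, the Hammersley–Welsh a-priori bound and floor `-3/2`,
`LedgerBootstrap` is the statement of `stub_ledgerBootstrap` verbatim. [folklore] -/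
theorem ledgerBootstrap_stub_iff :
    LedgerBootstrap (fun κ => 0 ≤ κ) HWApriori (-(3 : ℝ) / 2) ↔
    ∀ (κ π : ℝ), 0 ≤ κ →
    ∀ (t D U : ℕ → ℝ), (∀ n : ℕ, 0 ≤ t n) →
      (∃ K : ℝ, ∀ n : ℕ, t n ≤ Real.exp (K * Real.sqrt n)) →
      (∃ K₁ : ℝ, 0 < K₁ ∧ ∀ i : ℕ, D i ≤ K₁ * U i) →
      (∃ c : ℝ, 0 < c ∧ ∃ i₀ : ℕ, ∀ i : ℕ, i₀ ≤ i →
          c * (2 : ℝ) ^ ((κ - 1) * (i : ℝ)) * (∑ n ∈ Finset.Ico (2 ^ i) (2 ^ (i + 1)), t n) ^ 2 ≤ D i) →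
      (∃ C b : ℝ, ∀ i : ℕ,
          U i ≤ C * ((i : ℝ) + 1) ^ b * (2 : ℝ) ^ (-π * (i : ℝ)) *
              (∑ n ∈ Finset.Ico (2 ^ (i + 1)) (2 ^ (i + 1 + 1)), t n)
            + C * (2 : ℝ) ^ (-(4 : ℝ) * (i : ℝ))) →
      ∀ s : ℝ, 1 - (κ + π) < s → -(3 : ℝ) / 2 ≤ s →
        ∃ C' : ℝ, ∀ i : ℕ, (∑ n ∈ Finset.Ico (2 ^ i) (2 ^ (i + 1)), t n) ≤ C' * (2 : ℝ) ^ (s * (i : ℝ)) :=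
  Iff.rfl

/-! ## Spike sequences: one term per dyadic block -/

/-- The sequence carrying the value `g i` at `n = 2^i` and `0` elsewhere. -/
def spike (g : ℕ → ℝ) (n : ℕ) : ℝ := if n = 2 ^ Nat.log 2 n then g (Nat.log 2 n) else 0

/-- The spike value at `2^i`. [folklore] -/
theorem spike_pow (g : ℕ → ℝ) (i : ℕ) : spike g (2 ^ i) = g i := by
  simp [spike, Nat.log_pow Nat.one_lt_two]

/-- A spike sequence with nonnegative values is nonnegative. [folklore] -/
theorem spike_nonneg {g : ℕ → ℝ} (hg : ∀ i, 0 ≤ g i) (n : ℕ) : 0 ≤ spike g n := by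
  unfold spike; split_ifs <;> simp [hg]

/-- A spike sequence is bounded by any nonnegative bound of its values. [folklore] -/
theorem spike_le {g : ℕ → ℝ} {M : ℝ} (hM : 0 ≤ M) (hg : ∀ i, g i ≤ M) (n : ℕ) : spike g n ≤ M := by
  unfold spike; split_ifs <;> simp [hg, hM]

/-- The dyadic block sum of a spike sequence is its spike value. [folklore] -/
theorem sum_block_spike (g : ℕ → ℝ) (i : ℕ) :
    ∑ n ∈ Finset.Ico (2 ^ i) (2 ^ (i + 1)), spike g n = g i := by
  rw [Finset.sum_eq_single_of_mem (2 ^ i) (by simp [Nat.pow_lt_pow_right]) ?_, spike_pow]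
  intro n hn hne
  rw [Finset.mem_Ico] at hn
  have hlog : Nat.log 2 n = i := Nat.log_eq_of_pow_le_of_lt_pow hn.1 hn.2
  simp [spike, hlog, hne]

/-- A spike sequence bounded by `1` satisfies the a-priori bound with `K = 0`. [folklore] -/
theorem hwApriori_spike {g : ℕ → ℝ} (hg : ∀ i, g i ≤ 1) : HWApriori (spike g) :=
  ⟨0, fun n => by simpa using spike_le zero_le_one hg n⟩

/-! ## Exponent algebra and the unboundedness of `2^{r i}` -/

/-- `2^{a i} (2^{b i})² = 2^{(a+2b) i}`. [folklore] -/
theorem two_rpow_mul_sq (a b : ℝ) (i : ℕ) :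
    (2 : ℝ) ^ (a * i) * ((2 : ℝ) ^ (b * i)) ^ 2 = 2 ^ ((a + 2 * b) * i) := by
  rw [← Real.rpow_natCast _ 2, ← Real.rpow_mul two_pos.le, ← Real.rpow_add two_pos]
  congr 1; push_cast; ring

/-- `2^{(a-r) i} = 2^{a i} / 2^{r i}`. [folklore] -/
theorem two_rpow_sub_mul (a r : ℝ) (i : ℕ) :
    (2 : ℝ) ^ ((a - r) * i) = 2 ^ (a * i) * (2 ^ (r * i))⁻¹ := by
  rw [← Real.rpow_neg two_pos.le, ← Real.rpow_add two_pos]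
  congr 1; ring

/-- `2^{a i} ≤ 1` for `a ≤ 0`. [folklore] -/
theorem two_rpow_nonpos_le_one {a : ℝ} (ha : a ≤ 0) (i : ℕ) : (2 : ℝ) ^ (a * i) ≤ 1 :=
  Real.rpow_le_one_of_one_le_of_nonpos one_le_two (mul_nonpos_of_nonpos_of_nonneg ha (Nat.cast_nonneg i))

/-- `2^{r i}` is unbounded in `i` for `r > 0`. [folklore] -/
theorem exists_lt_two_rpow {r : ℝ} (hr : 0 < r) (C : ℝ) : ∃ i : ℕ, C < (2 : ℝ) ^ (r * i) := by
  obtain ⟨n, hn⟩ := exists_nat_gt C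
  refine ⟨n * ⌈r⁻¹⌉₊, hn.trans_le ?_⟩
  have h2n : (n : ℝ) ≤ (2 : ℝ) ^ (n : ℝ) := by
    rw [Real.rpow_natCast]; exact_mod_cast (Nat.lt_two_pow_self).le
  refine h2n.trans (Real.rpow_le_rpow_of_exponent_le one_le_two ?_)
  have hk : 1 ≤ r * ⌈r⁻¹⌉₊ := by
    calc (1 : ℝ) = r * r⁻¹ := (mul_inv_cancel₀ hr.ne').symm
      _ ≤ r * ⌈r⁻¹⌉₊ := mul_le_mul_of_nonneg_left (Nat.le_ceil _) hr.le
  calc (n : ℝ) = n * 1 := (mul_one _).symm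
    _ ≤ n * (r * ⌈r⁻¹⌉₊) := mul_le_mul_of_nonneg_left hk (Nat.cast_nonneg n)
    _ = r * ((n * ⌈r⁻¹⌉₊ : ℕ) : ℝ) := by push_cast; ring

/-- The common endgame of the three mutations: `2^{a i} ≤ C' 2^{(a-r) i}` for all `i` is absurd
when `r > 0`. [folklore] -/
theorem false_of_rpow_le {a r C' : ℝ} (hr : 0 < r)
    (h : ∀ i : ℕ, (2 : ℝ) ^ (a * i) ≤ C' * (2 : ℝ) ^ ((a - r) * i)) : False := by
  have hb : ∀ i : ℕ, (2 : ℝ) ^ (r * i) ≤ C' := by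
    intro i
    have hi := h i
    rw [two_rpow_sub_mul] at hi
    have hP := Real.rpow_pos_of_pos two_pos (a * i)
    have hQ := Real.rpow_pos_of_pos two_pos (r * i)
    -- `2^{a i} ≤ C' 2^{a i} / 2^{r i}` ⟹ `2^{r i} ≤ C'`
    have : (2 : ℝ) ^ (a * i) * (2 : ℝ) ^ (r * i) ≤ (2 : ℝ) ^ (a * i) * C' := by
      calc (2 : ℝ) ^ (a * i) * (2 : ℝ) ^ (r * i)
          ≤ C' * ((2 : ℝ) ^ (a * i) * ((2 : ℝ) ^ (r * i))⁻¹) * (2 : ℝ) ^ (r * i) :=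
            mul_le_mul_of_nonneg_right hi hQ.le
        _ = (2 : ℝ) ^ (a * i) * C' := by field_simp
    exact le_of_mul_le_mul_left this hP
  obtain ⟨i, hi⟩ := exists_lt_two_rpow hr C'
  exact (lt_irrefl _) ((hb i).trans_lt hi)

/-! ## Mutation 1: the side condition `0 ≤ κ` is load-bearing -/

/-- **WITHOUT `0 ≤ κ` the ledger bootstrap is FALSE** (`κ = -2, π = 5`, `R_i = 2^{-i/2}`,
`D = U = 2^{-4i}`, `s = -3/2`). [folklore] -/
theorem not_ledgerBootstrap_without_kappa_nonneg :
    ¬ LedgerBootstrap (fun _ => True) HWApriori (-(3 : ℝ) / 2) := by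
  intro H
  set g : ℕ → ℝ := fun i => (2 : ℝ) ^ ((-(1 : ℝ) / 2) * i) with hg
  set D : ℕ → ℝ := fun i => (2 : ℝ) ^ ((-(4 : ℝ)) * i) with hD
  have hg1 : ∀ i, g i ≤ 1 := fun i => two_rpow_nonpos_le_one (by norm_num) i
  have hR : ∀ i, ∑ n ∈ Finset.Ico (2 ^ i) (2 ^ (i + 1)), spike g n = g i := sum_block_spike g
  obtain ⟨C', hC'⟩ := H (-2) 5 trivial (spike g) D D (spike_nonneg fun i => (Real.rpow_pos_of_pos two_pos _).le)
    (hwApriori_spike hg1) ⟨1, one_pos, fun i => by rw [one_mul]⟩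
    ⟨1, one_pos, 0, fun i _ => by
      rw [hR, one_mul, hg, hD, two_rpow_mul_sq]; norm_num⟩
    ⟨1, 0, fun i => by
      rw [hR]
      have h0 : 0 ≤ 1 * ((i : ℝ) + 1) ^ (0 : ℝ) * (2 : ℝ) ^ (-(5 : ℝ) * i) * g (i + 1) := by
        simp only [Real.rpow_zero, mul_one, one_mul]; exact mul_nonneg (Real.rpow_pos_of_pos two_pos _).le (Real.rpow_pos_of_pos two_pos _).le
      linarith⟩
    (-(3 : ℝ) / 2) (by norm_num) le_rfl
  refine false_of_rpow_le (a := -(1 : ℝ) / 2) (r := 1) (C' := C') one_pos fun i => ?_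
  have := hC' i
  rw [hR, hg] at this
  convert this using 3; norm_num

/-! ## Mutation 2: the a-priori bound is load-bearing -/

/-- **WITHOUT the a-priori bound `t_n ≤ e^{K√n}` the ledger bootstrap is FALSE** (`κ = 0, π = 1`,
`R_i = 2^{2^i}`, `D_i = U_i = 2^{-i} R_i² = 2^{-i} R_{i+1}`, `s = 1`). [folklore] -/
theorem not_ledgerBootstrap_without_apriori :
    ¬ LedgerBootstrap (fun κ => 0 ≤ κ) (fun _ => True) (-(3 : ℝ) / 2) := by
  intro H
  set g : ℕ → ℝ := fun i => (2 : ℝ) ^ (2 ^ i) with hg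
  set D : ℕ → ℝ := fun i => 1 * (2 : ℝ) ^ (((0 : ℝ) - 1) * i) * (g i) ^ 2 with hD
  have hgsq : ∀ i, (g i) ^ 2 = g (i + 1) := fun i => by
    rw [hg]; simp only; rw [← pow_mul, ← pow_succ]
  have hR : ∀ i, ∑ n ∈ Finset.Ico (2 ^ i) (2 ^ (i + 1)), spike g n = g i := sum_block_spike g
  obtain ⟨C', hC'⟩ := H 0 1 le_rfl (spike g) D D (spike_nonneg fun i => by positivity) trivial
    ⟨1, one_pos, fun i => by rw [one_mul]⟩
    ⟨1, one_pos, 0, fun i _ => by rw [hR]⟩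
    ⟨1, 0, fun i => by
      rw [hR, hD]; simp only
      rw [hgsq, Real.rpow_zero]
      have : 0 ≤ (1 : ℝ) * (2 : ℝ) ^ (-(4 : ℝ) * i) := by positivity
      have e : ((0 : ℝ) - 1) * i = -(1 : ℝ) * i := by ring
      rw [e]; linarith⟩
    1 (by norm_num) (by norm_num)
  -- `2^{2^i} ≤ C' 2^i` for all `i` is absurd
  have hb : ∀ i : ℕ, (2 : ℝ) ^ i ≤ C' := by
    intro i
    have hi := hC' i
    rw [hR, hg, one_mul, Real.rpow_natCast] at hi
    have h2i : 2 * i ≤ 2 ^ i := by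
      rcases i with _ | j
      · simp
      · rw [pow_succ']; exact Nat.mul_le_mul_left 2 (Nat.succ_le_of_lt Nat.lt_two_pow_self)
    have h4 : (2 : ℝ) ^ i * (2 : ℝ) ^ i ≤ (2 : ℝ) ^ (2 ^ i) := by
      rw [← pow_add, ← two_mul]; exact pow_le_pow_right₀ one_le_two h2i
    exact le_of_mul_le_mul_right (h4.trans hi) (by positivity)
  obtain ⟨n, hn⟩ := exists_nat_gt C'
  have : (n : ℝ) < (2 : ℝ) ^ n := by exact_mod_cast Nat.lt_two_pow_self
  exact (lt_irrefl _) ((hn.trans this).trans_le (hb n))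

/-! ## Mutation 3: the floor `-3/2 ≤ s` is sharp -/

/-- **The floor `-3/2` cannot be lowered**: with floor `-3/2 - ε` (`ε > 0`) the ledger bootstrap is
FALSE (`κ = 0, π = 10`, `R_i = 2^{-3i/2}`, `D = U = 2^{-4i}`, `s = -3/2 - min(ε,1)/2`). [folklore] -/
theorem not_ledgerBootstrap_floor_lowered {ε : ℝ} (hε : 0 < ε) :
    ¬ LedgerBootstrap (fun κ => 0 ≤ κ) HWApriori (-(3 : ℝ) / 2 - ε) := by
  intro H
  set δ : ℝ := min ε 1 / 2 with hδ
  have hδpos : 0 < δ := by rw [hδ]; positivity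
  have hδε : δ ≤ ε := by
    rw [hδ]; linarith [min_le_left ε 1, le_min hε.le zero_le_one]
  have hδ1 : δ ≤ 1 / 2 := by rw [hδ]; linarith [min_le_right ε 1]
  set g : ℕ → ℝ := fun i => (2 : ℝ) ^ ((-(3 : ℝ) / 2) * i) with hg
  set D : ℕ → ℝ := fun i => 1 * (2 : ℝ) ^ (((0 : ℝ) - 1) * i) * (g i) ^ 2 with hD
  have hg1 : ∀ i, g i ≤ 1 := fun i => two_rpow_nonpos_le_one (by norm_num) i
  have hD4 : ∀ i, D i = (2 : ℝ) ^ (-(4 : ℝ) * i) := fun i => by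
    rw [hD, hg]; simp only; rw [one_mul, two_rpow_mul_sq]; norm_num
  have hR : ∀ i, ∑ n ∈ Finset.Ico (2 ^ i) (2 ^ (i + 1)), spike g n = g i := sum_block_spike g
  obtain ⟨C', hC'⟩ := H 0 10 le_rfl (spike g) D D (spike_nonneg fun i => (Real.rpow_pos_of_pos two_pos _).le)
    (hwApriori_spike hg1) ⟨1, one_pos, fun i => by rw [one_mul]⟩
    ⟨1, one_pos, 0, fun i _ => by rw [hR]⟩
    ⟨1, 0, fun i => by
      rw [hR, hD4]
      have h0 : 0 ≤ 1 * ((i : ℝ) + 1) ^ (0 : ℝ) * (2 : ℝ) ^ (-(10 : ℝ) * i) * g (i + 1) := by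
        simp only [Real.rpow_zero, mul_one, one_mul]; exact mul_nonneg (Real.rpow_pos_of_pos two_pos _).le (Real.rpow_pos_of_pos two_pos _).le
      linarith⟩
    (-(3 : ℝ) / 2 - δ) (by linarith) (by linarith)
  refine false_of_rpow_le (a := -(3 : ℝ) / 2) (r := δ) (C' := C') hδpos fun i => ?_
  have := hC' i
  rwa [hR, hg] at this

/-- Summary: the three analytic inputs of `stub_ledgerBootstrap` are each load-bearing. [folklore] -/
theorem ledgerBootstrap_loadBearing :
    (¬ LedgerBootstrap (fun _ => True) HWApriori (-(3 : ℝ) / 2)) ∧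
    (¬ LedgerBootstrap (fun κ => 0 ≤ κ) (fun _ => True) (-(3 : ℝ) / 2)) ∧
    (∀ ε : ℝ, 0 < ε → ¬ LedgerBootstrap (fun κ => 0 ≤ κ) HWApriori (-(3 : ℝ) / 2 - ε)) :=
  ⟨not_ledgerBootstrap_without_kappa_nonneg, not_ledgerBootstrap_without_apriori,
    fun _ hε => not_ledgerBootstrap_floor_lowered hε⟩

end Summit.CriticalPhenomena.SAWScalingLimit.Theorems.CriticalBubbleBound.Negative

end
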